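import Summits.PneNP.PneNP.Theorems.LatticeMagicTaylorMinorantsBuySqrtKMoments

/-!
# Route LatticeMagic — support item `TaylorMinorantsBuySqrtK` (stmt-PneNP-2329)

`Summit.PneNP.PneNP.Theses.LatticeMagic.TaylorMinorantsBuySqrtK`: for `0 < r`, `K ≤ n`, weights
`c_j`, dual vectors `w_j ∈ ℝⁿ` and orders `M_j ≤ K` with the parity rule (`c_j ≥ 0 ⇒ M_j` odd,
`c_j < 0 ⇒ M_j` even) and every nonzero `w_j` of norm `≥ 2√(Kn)/r`, some `e` with `‖e‖ ≤ r` has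
`Σ_j c_j T_{M_j}(2π⟪w_j,e⟫) ≤ Σ_{w_j=0} c_j − Σ_{w_j≠0} |c_j|`, where
`T_M(y) = Σ_{i≤M} (−1)^i y^{2i}/(2i)!` — order-`K` Taylor-minorant certificates are blind on every
lattice whose dual has no vector shorter than `2√(Kn)/r` (calibration of the Aharonov–Regev /
Aggarwal-et-al. certificate family; AharonovRegev2005 §6.1 is `K = 1`, arXiv:2211.11693 Thm 1.2 is
order `k`).

PROOF (lattice-free, elementary). Average the certificate polynomial `P` against the radial weight
`(r² − ‖e‖²)₊` (files `…Weight`, `…Moments`): by `taylorMinorants_integral_certificate_le`,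
`∫ P · (r² − ‖x‖²)₊ ≤ RHS · ∫ (r² − ‖x‖²)₊`; if `P > RHS` on the closed ball then
`(P − RHS) · (r² − ‖x‖²)₊` is continuous, nonnegative, compactly supported and positive at `0`, so
its integral is positive — contradiction.  No named facts are used; axioms are the standard three.
-/

namespace Summit.PneNP.PneNP.Theorems

open MeasureTheory
open scoped InnerProductSpace
open Summit.PneNP.PneNP.Theorems.TaylorMinorants

/-- **The averaged inequality.** Under the hypotheses of `TaylorMinorantsBuySqrtK`,
`∫ P(x) (r² − ‖x‖²)₊ dx ≤ (Σ_{w_j = 0} c_j − Σ_{w_j ≠ 0} |c_j|) · ∫ (r² − ‖x‖²)₊ dx`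
for the certificate polynomial `P = Σ_j c_j T_{M_j}(2π⟪w_j, ·⟫)`. -/
theorem taylorMinorants_integral_certificate_le {n K N : ℕ} {r : ℝ} (hr : 0 < r) (hKn : K ≤ n)
    (c : Fin N → ℝ) (w : Fin N → EuclideanSpace ℝ (Fin n)) (M : Fin N → ℕ)
    (hyp : ∀ j, M j ≤ K ∧ (0 ≤ c j → Odd (M j)) ∧ (c j < 0 → Even (M j)) ∧
      (w j = 0 ∨ 2 * Real.sqrt ((K : ℝ) * n) / r ≤ ‖w j‖)) :
    ∫ x : EuclideanSpace ℝ (Fin n), (∑ j, c j * ∑ i ∈ Finset.range (M j + 1),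
        (-1 : ℝ) ^ i * (2 * Real.pi * ⟪w j, x⟫_ℝ) ^ (2 * i) / (Nat.factorial (2 * i) : ℝ))
        * max (r ^ 2 - ‖x‖ ^ 2) 0
      ≤ ((∑ j ∈ Finset.univ.filter (fun j => w j = 0), c j)
          - ∑ j ∈ Finset.univ.filter (fun j => w j ≠ 0), |c j|)
        * ∫ x : EuclideanSpace ℝ (Fin n), max (r ^ 2 - ‖x‖ ^ 2) 0 := by
  -- abbreviate the Taylor polynomial of the `j`-th term
  set T : Fin N → EuclideanSpace ℝ (Fin n) → ℝ := fun j x => ∑ i ∈ Finset.range (M j + 1),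
    (-1 : ℝ) ^ i * (2 * Real.pi * ⟪w j, x⟫_ℝ) ^ (2 * i) / (Nat.factorial (2 * i) : ℝ) with hT
  have hTc : ∀ j, Continuous (T j) := fun j => continuous_taylorPoly (M j) (w j)
  have hI : ∀ j, Integrable (fun x : EuclideanSpace ℝ (Fin n) =>
      T j x * max (r ^ 2 - ‖x‖ ^ 2) 0) := fun j => integrable_mul_wt hr.le (hTc j)
  have hpt : ∀ x : EuclideanSpace ℝ (Fin n), (∑ j, c j * T j x) * max (r ^ 2 - ‖x‖ ^ 2) 0
      = ∑ j, c j * (T j x * max (r ^ 2 - ‖x‖ ^ 2) 0) := by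
    intro x
    rw [Finset.sum_mul]
    refine Finset.sum_congr rfl ?_
    intro j _
    ring
  show ∫ x : EuclideanSpace ℝ (Fin n), (∑ j, c j * T j x) * max (r ^ 2 - ‖x‖ ^ 2) 0 ≤ _
  simp_rw [hpt]
  rw [integral_finsetSum _ (fun j _ => (hI j).const_mul _)]
  have hj : ∀ j, ∫ x, c j * (T j x * max (r ^ 2 - ‖x‖ ^ 2) 0)
      ≤ (if w j = 0 then c j else -|c j|) *
        ∫ x : EuclideanSpace ℝ (Fin n), max (r ^ 2 - ‖x‖ ^ 2) 0 := by
    intro j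
    rw [integral_const_mul]
    obtain ⟨hMK, hodd, heven, hw⟩ := hyp j
    split_ifs with h0
    · have hT1 : ∀ x, T j x = 1 := by
        intro x
        simp only [hT, h0]
        exact taylorPoly_zero (M j) x
      simp_rw [hT1]
      simp
    · have hw' : 2 * Real.sqrt ((K : ℝ) * n) / r ≤ ‖w j‖ := by
        rcases hw with hw | hw
        · exact absurd hw h0
        · exact hw
      have hint := integral_taylorPoly_mul_wt hr.le (M j) (w j)
      simp only [hT]
      rw [hint]
      exact term_bound hr hKn hMK (c j) (w j) hodd heven hw'
  calc ∑ j, ∫ x, c j * (T j x * max (r ^ 2 - ‖x‖ ^ 2) 0)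
      ≤ ∑ j, (if w j = 0 then c j else -|c j|) *
          ∫ x : EuclideanSpace ℝ (Fin n), max (r ^ 2 - ‖x‖ ^ 2) 0 :=
        Finset.sum_le_sum (fun j _ => hj j)
    _ = ((∑ j ∈ Finset.univ.filter (fun j => w j = 0), c j)
          - ∑ j ∈ Finset.univ.filter (fun j => w j ≠ 0), |c j|)
        * ∫ x : EuclideanSpace ℝ (Fin n), max (r ^ 2 - ‖x‖ ^ 2) 0 := by
        rw [← Finset.sum_mul, Finset.sum_ite, Finset.sum_neg_distrib]
        ring

/-- **`TaylorMinorantsBuySqrtK` holds** (route `LatticeMagic`, item stmt-PneNP-2329).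
Order-`K` Taylor-minorant certificates are blind whenever every nonzero dual vector has norm
`≥ 2√(Kn)/r`: some `e` with `‖e‖ ≤ r` has
`Σ_j c_j T_{M_j}(2π⟪w_j,e⟫) ≤ Σ_{w_j=0} c_j − Σ_{w_j≠0} |c_j|`.
Proof: average against the radial weight `(r² − ‖e‖²)₊`; the even moments of `⟪w,e⟫` satisfy
`(n+2i+4) m_{i+1} = (2i+1)‖w‖²r² m_i` (two integrations by parts), so the normalised Taylor terms at
least double at each order `≤ K ≤ n` (`8π²/5 ≥ 2`), and the alternating sums have the sign of their
parity; a continuous nonnegative function with positive value at `0` has positive integral. -/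
theorem taylorMinorantsBuySqrtK_proof :
    Summit.PneNP.PneNP.Theses.LatticeMagic.TaylorMinorantsBuySqrtK := by
  unfold Summit.PneNP.PneNP.Theses.LatticeMagic.TaylorMinorantsBuySqrtK
  intro n K N r hr hKn c w M hyp
  have havg := taylorMinorants_integral_certificate_le hr hKn c w M hyp
  set P : EuclideanSpace ℝ (Fin n) → ℝ := fun x => ∑ j, c j * ∑ i ∈ Finset.range (M j + 1),
    (-1 : ℝ) ^ i * (2 * Real.pi * ⟪w j, x⟫_ℝ) ^ (2 * i) / (Nat.factorial (2 * i) : ℝ) with hP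
  set RHS : ℝ := (∑ j ∈ Finset.univ.filter (fun j => w j = 0), c j)
    - ∑ j ∈ Finset.univ.filter (fun j => w j ≠ 0), |c j| with hRHS
  by_contra hcon
  push Not at hcon
  have hPc : Continuous P := by
    have := fun j => continuous_taylorPoly (n := n) (M j) (w j)
    simp only [hP]
    fun_prop
  have hF : ∀ x : EuclideanSpace ℝ (Fin n), 0 ≤ (P x - RHS) * max (r ^ 2 - ‖x‖ ^ 2) 0 := by
    intro x
    rcases le_or_gt ‖x‖ r with hx | hx
    · have h' : RHS < P x := hcon x hx
      exact mul_nonneg (by linarith) (le_max_right _ _)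
    · rw [wt_eq_zero_of_lt hr.le hx, mul_zero]
  have hF0 : (P 0 - RHS) * max (r ^ 2 - ‖(0 : EuclideanSpace ℝ (Fin n))‖ ^ 2) 0 ≠ 0 := by
    have h' : RHS < P 0 := hcon 0 (by simpa using hr.le)
    have hw0 : max (r ^ 2 - ‖(0 : EuclideanSpace ℝ (Fin n))‖ ^ 2) 0 = r ^ 2 := by
      simp [sq_nonneg]
    rw [hw0]
    have : 0 < r ^ 2 := by positivity
    exact (mul_pos (by linarith) this).ne'
  have hcont : Continuous fun x : EuclideanSpace ℝ (Fin n) =>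
      (P x - RHS) * max (r ^ 2 - ‖x‖ ^ 2) 0 := by
    fun_prop
  have hsupp : HasCompactSupport fun x : EuclideanSpace ℝ (Fin n) =>
      (P x - RHS) * max (r ^ 2 - ‖x‖ ^ 2) 0 :=
    hasCompactSupport_mul_wt hr.le _
  have hpos := Continuous.integral_pos_of_hasCompactSupport_nonneg_nonzero
    (μ := (volume : Measure (EuclideanSpace ℝ (Fin n)))) hcont hsupp (fun x => hF x) hF0
  have hI1 : Integrable (fun x : EuclideanSpace ℝ (Fin n) => P x * max (r ^ 2 - ‖x‖ ^ 2) 0) :=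
    integrable_mul_wt hr.le hPc
  have hI2 : Integrable (fun x : EuclideanSpace ℝ (Fin n) => RHS * max (r ^ 2 - ‖x‖ ^ 2) 0) :=
    integrable_mul_wt hr.le continuous_const
  have hsplit : ∫ x : EuclideanSpace ℝ (Fin n), (P x - RHS) * max (r ^ 2 - ‖x‖ ^ 2) 0
      = (∫ x : EuclideanSpace ℝ (Fin n), P x * max (r ^ 2 - ‖x‖ ^ 2) 0)
        - RHS * ∫ x : EuclideanSpace ℝ (Fin n), max (r ^ 2 - ‖x‖ ^ 2) 0 := by
    simp_rw [sub_mul]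
    rw [integral_sub hI1 hI2, integral_const_mul]
  rw [hsplit] at hpos
  have havg' : ∫ x : EuclideanSpace ℝ (Fin n), P x * max (r ^ 2 - ‖x‖ ^ 2) 0
      ≤ RHS * ∫ x : EuclideanSpace ℝ (Fin n), max (r ^ 2 - ‖x‖ ^ 2) 0 := havg
  linarith

end Summit.PneNP.PneNP.Theorems
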